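import Summits.BirchSwinnertonDyer.BirchSwinnertonDyer.Theorems.PrintCf2SplitBadTwoKummerIndependence
import Summits.BirchSwinnertonDyer.BirchSwinnertonDyer.Theorems.PrintCf2SplitBadTwoRestrictedSelmerBottomValueOfFactors
import Summits.BirchSwinnertonDyer.BirchSwinnertonDyer.Theorems.PrintCf2SplitBadTwoRestrictedSelmerBottomShaEigenImage
import Summits.BirchSwinnertonDyer.BirchSwinnertonDyer.Theorems.PrintCf2SplitBadTwoCMPrimaryStructure
import HarnessLib

/-!
# Crux `PrintCf2.SplitBadTwoRankOneOfFacts` (stmt-BirchSwinnertonDyer-20368), road α v10.3, S3c residual (R-BV), input (H1′) — file 5 of the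
# branch argument: ON ROAD α's FRAME, (H1′) ⟸ (T-loc at `v`) ∧ `hfinB′`, by name

Cell `bsd-print-cf2`, EXTRA WIDTH seat `bsd-line-cf2-p1-w3` g9 (prover-bsd-line-cf2-p1-w3-g9-0); `--supports stmt-BirchSwinnertonDyer-20368`
(helper, Theses-free). HONEST FRAMING: nothing here closes the crux or a registered stub; BSD is not proved by any of this; no summit statement
is proved by this seat. No definition, no named fact, no `sorry`, no kit. beyond-print theorem: no.

WHAT. p673070's `comap_kummer_le_ker_resOfLe_of_finite_conj_of_cyclic` needs, besides (T-loc) and `hfinB′`: `IsUnit (r − r′)`, `π² = π − 2`,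
complementary summands with projectors `e`, `e′` (`e ∘ ι = id`, `e′ ∘ ι′ = id`, `e′ = 0` on `W*`, `ι e + ι′ e′ = id`) and a `K`-point of infinite
order. On every frame of S3c (member `C • W = cm7^{(d)}`, `K` imaginary quadratic, `π² = π − 2`, `r² = r − 2`, `r′ = 1 − r`, the `ℚ`-generator `P`)
these are THEOREMS of the tree: `CMPrimes.two_dvd_or_two_dvd_one_sub_of_root` (`r − (1 − r)` is a `2`-adic unit),
`endEigenPrimaryTorsion_compl_of_frame` (-w7), `exists_eigenProjector` (-w7, twice), `coe_proj_add_coe_proj` (-w7), and `P ↦ E(K)` by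
`Affine.Point.map (Algebra.ofId ℚ K)` (injective). HENCE **`comap_kummer_le_ker_resOfLe_of_frame_of_cyclic`**: for every frame,
(H1′) «`ι_*⁻¹(res_⊤ range κ) ≤ ker loc_v`» — the per-frame instance of the hypothesis hH1 of `rBV_of_three_factor_values` (p665606) — ⟸
(T-loc at `v`) «the `2`-torsion of `loc_v(res_⊤ range κ)` is cyclic» ∧ `hfinB′ : Finite 𝔖_v(K, E[𝔮_{1−r}^∞])`. No pinning clause, no (H1-pts),
no formal group: the local CM input of the bottom value is the global finiteness of the CONJUGATE restricted group plus the cyclicity of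
`(E(K_v) ⊗ ℚ₂/ℤ₂)[2]`.

presearch: nothing beyond the tree (assembly). No Literature fact filed.

References: [Agboola2007] §6 (arXiv p0014:L5); [GreenbergLNM1716] §2 Prop. 2.1; [Rubin1999] §2.
-/

noncomputable section

open scoped Classical

set_option linter.dupNamespace false
set_option autoImplicit false

open NumberField IsDedekindDomain Field WeierstrassCurve
open Literature.NumberTheory.EllipticCurves Literature.NumberTheory.EllipticCurves.GreenbergSelmer
open Literature.NumberTheory.EllipticCurves.Castella2018.AcSelmer
open Literature.NumberTheory.EllipticCurves.Agboola2007
open Literature.NumberTheory.EllipticCurves.ResKernel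
open Literature.NumberTheory.GaloisRepresentations

namespace Summit.BirchSwinnertonDyer.BirchSwinnertonDyer.Theorems.PrintCf2.RestrictedSelmerPair

open Summit.BirchSwinnertonDyer.BirchSwinnertonDyer.Theorems.PrintCf2.CMPrimes
open Summit.BirchSwinnertonDyer.BirchSwinnertonDyer.Theorems.PrintCf2.AdditiveAtSeven

variable {K : Type} [Field K] [NumberField K]

/-- **A `ℚ`-point of infinite order gives a `K`-point of infinite order** (`E(ℚ) ↪ E(K)` is an injective homomorphism).
[cite: SilvermanAEC2009, VIII §1] -/
theorem not_isOfFinAddOrder_map_ofId (W : WeierstrassCurve ℚ) {P : W.toAffine.Point} (hP : ¬ IsOfFinAddOrder P) :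
    ¬ IsOfFinAddOrder (Affine.Point.map (W' := W) (F := ℚ) (Algebra.ofId ℚ K) P) := fun h ↦
  hP (((Affine.Point.map_injective (W' := W) (F := ℚ) (Algebra.ofId ℚ K)).isOfFinAddOrder_iff
    (f := Affine.Point.map (W' := W) (F := ℚ) (Algebra.ofId ℚ K))).mp h)

/-- **(H1′) ON THE FRAME ⟸ (T-loc at `v`) ∧ `hfinB′`.** For a member `C • W = cm7^{(d)}` (`d ≠ 0`) over an imaginary quadratic `K`, a finite
place `v`, `π ∈ End_K(E_K)` with `π² = π − 2`, a `2`-adic root `r` (`r² = r − 2`), and a `ℚ`-point `P` of infinite order: IF the `2`-torsion of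
the local image `loc_v(res_⊤ range κ) ≤ H¹(⊤ ⊓ D_v, E[2^∞])` of the global Kummer group is cyclic (T-loc) and Agboola's restricted group of the
CONJUGATE summand `𝔖_v(K, E[𝔮_{1−r}^∞])` is finite (hfinB′), THEN the `E[𝔮_r^∞]`-components of the global Kummer classes are locally zero at `v`:
`ι_*⁻¹(res_⊤ range κ) ≤ ker loc_v` — hypothesis hH1 of `rBV_of_three_factor_values`, per frame. [cite: Agboola2007, §6 (arXiv p0014:L5)]
[cite: GreenbergLNM1716, §2 Prop. 2.1] -/
theorem comap_kummer_le_ker_resOfLe_of_frame_of_cyclic {d : ℤ} (hd0 : d ≠ 0) (W : WeierstrassCurve ℚ) [W.IsElliptic]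
    (C : WeierstrassCurve.VariableChange ℚ) (hCW : C • W = cm7.quadraticTwist (d : ℚ)) (hK : IsImaginaryQuadratic K)
    (v : HeightOneSpectrum (𝓞 K)) (π : (W.baseChange K).endRing) (hrel : (π : AddMonoid.End (W.baseChange K).geomPoints) * π = π - 2)
    {r : ℤ_[2]} (hr : r * r = r - 2) (P : W.toAffine.Point) (hP : ¬ IsOfFinAddOrder P)
    (hcyc : ∀ x ∈ ((((W.baseChange K).kummerMapPInfty 2 (W.baseChange K).zsmul_geomPoints_surjective_holds).range).map
        (resSubgroup ⊤ ((W.baseChange K).geomPrimaryTorsion 2))).map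
          (resOfLe ((W.baseChange K).geomPrimaryTorsion 2) (inf_le_left : ⊤ ⊓ decomp v ≤ ⊤)),
      ∀ y ∈ ((((W.baseChange K).kummerMapPInfty 2 (W.baseChange K).zsmul_geomPoints_surjective_holds).range).map
        (resSubgroup ⊤ ((W.baseChange K).geomPrimaryTorsion 2))).map
          (resOfLe ((W.baseChange K).geomPrimaryTorsion 2) (inf_le_left : ⊤ ⊓ decomp v ≤ ⊤)),
      2 • x = 0 → 2 • y = 0 → x ≠ 0 → ∃ m : ℤ, y = m • x)
    (hfin' : Finite (restrictedSelmerBase ↥((W.baseChange K).endEigenPrimaryTorsion 2 π (1 - r)) 2 v)) :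
    ((((W.baseChange K).kummerMapPInfty 2 (W.baseChange K).zsmul_geomPoints_surjective_holds).range).map
        (resSubgroup ⊤ ((W.baseChange K).geomPrimaryTorsion 2))).comap
          (resH1Hom (ContinuousMonoidHom.id (⊤ : Subgroup (absoluteGaloisGroup K)))
            ((W.baseChange K).endEigenPrimaryTorsion 2 π r).subtype (fun _ _ ↦ rfl)) ≤
      (resOfLe ↥((W.baseChange K).endEigenPrimaryTorsion 2 π r) (inf_le_left : ⊤ ⊓ decomp v ≤ ⊤)).ker := by
  haveI : Fact (Nat.Prime 2) := ⟨Nat.prime_two⟩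
  obtain ⟨hinf, hsup⟩ := endEigenPrimaryTorsion_compl_of_frame hd0 W C hCW K π hrel hr
  have hunit : IsUnit (r - (1 - r)) := (two_dvd_or_two_dvd_one_sub_of_root hr).2
  obtain ⟨e, he₁, -, he₃, he⟩ := exists_eigenProjector (W.baseChange K) 2 π r (1 - r) hinf hsup
  obtain ⟨e', he'₁, he'₂, -, he'⟩ := exists_eigenProjector (W.baseChange K) 2 π (1 - r) r (by rw [inf_comm]; exact hinf)
    (by rw [sup_comm]; exact hsup)
  have hsum := coe_proj_add_coe_proj (W.baseChange K) 2 π r (1 - r) e e' he₃ he'₁ he'₂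
  exact comap_kummer_le_ker_resOfLe_of_finite_conj_of_cyclic (W.baseChange K) 2 π r (1 - r) v hK hunit hrel hinf hsup e e' he₁ he he'₁
    he'₂ he' hsum (Affine.Point.map (W' := W) (F := ℚ) (Algebra.ofId ℚ K) P) (not_isOfFinAddOrder_map_ofId W hP) hcyc hfin'

end Summit.BirchSwinnertonDyer.BirchSwinnertonDyer.Theorems.PrintCf2.RestrictedSelmerPair

end
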